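import Summits.AtomisticToContinuum.HydrodynamicLimit.Theorems.StiffCollisionalRelaxationAprioriBoundsFibreDefs
import Literature.MathematicalPhysics.KineticTheory.HardSphereBBGKYLiouvilleFlow
import Literature.Analysis.FluidPDE.HardSphereMomentumConservation
import HarnessLib

/-!
# Equilibrium unit test of the stub `stub_hydroRate` (line `fibre-deficit-transfer`, crux `AprioriBounds`,
stmt-AtomisticToContinuum-14827)

Evidence file of the stub-worker of `stub_hydroRate` — the OPEN dynamical core of the line: under the crux
prefix, `LinearHydroRateAt`, a RATED fixed-time hydrodynamic limit for the five entropy-gradient test fields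
`(λ₀, u/θ, −1/θ)(s,·)` of the classical Euler solution (`∃ b p > 0`, `P_N(|ℓ_s ∘ Φ_s| > (N+1)^{-b}) ≤ (N+1)^{-p}`
eventually in `N`, for all `s ≤ t`).  Imports only landed modules; sorry-free; axioms
`propext, Classical.choice, Quot.sound`.

## (B) What is proved here: the EQUILIBRIUM INSTANCE (Galilean family: any constant drift `uc`)

* constant profiles `a₀ ≡ ac > 0`, `u₀ ≡ uc`, `θ₀ ≡ θc > 0` and the constant classical solution
  `ρ ≡ 1`, `u ≡ uc`, `θ ≡ θc` (a classical hs-Euler solution on `[0,T)` for every `σ, T`: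
  `DenseExcursionUntied.isHardSphereEulerSolution_const σ T uc one_pos hθc`, landed) — the same equilibrium rung
  `(σ ac θc uc)` as the sibling sub-goal `tiltedExcess_equilibrium`;
* `tiltExponent s (x, v) = λ₀ + ⟪uc, v⟫/θc − |v|²/(2θc)` (`tiltExponent_const`, `rfl`),
  `tiltMean s = λ₀ + |uc|²/(2θc) − 3/2` (`tiltMean_const`; `|𝕋³| = 1`, `volume_univ_T3`), hence the linear statistic
  is a function of the conserved totals `P = ∑ vᵢ`, `E = ½∑|vᵢ|²`:
  `ℓ_s(w) = 3/2 − |uc|²/(2θc) + (⟪uc, P(w)⟫ − E(w))/((N+1)θc)` (`linStat_const`), and on the good set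
  `ℓ_s(Φ_r z) = ℓ_s(z)` (`linStat_const_flow`: `HardSphereFlow.configEnergy_flow` + `configMomentum_flow`);
* per particle `Λ·(1, v, |v|²/2) − m = −Y(v)` with `Y(v) = θc⁻¹(|v − uc|²/2 − 3θc/2)`, so `ℓ_s(w) = −(N+1)⁻¹∑ᵢ Y(vᵢ)`;
  the Galilean shift `v = uc + √θc w` turns `Y` into `(|w|² − 3)/2` (`peculiarEnergy_shift`), whence under
  `N(uc, θc) = gaussMeasure uc θc` (`integral_gaussMeasure`): `E Y = 0` (`integral_norm_sq_stdGaussian`), `Y ∈ L²`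
  and `Var Y ≤ E Y² = K/4`, `K = gaussFourthMomentConst (Fin 3)` (landed Gaussian statics of `HardSphereEulerProofs`);
* Bienaymé–Chebyshev given the positions (`localGibbsMeasure_velFluct_le`) and `P_N(goodᶜ) = 0`:
  `P_N(|ℓ_s(Φ_s z)| > (N+1)^{-1/4}) ≤ (K/4)(N+1)^{-1/2} ≤ (N+1)^{-1/4}` once `(N+1)^{1/4} ≥ K/4` — i.e.
  **`LinearHydroRateAt σ ac θc uc 1 θc uc Φ t` with `b = p = 1/4`, for EVERY `σ ≤ 1/2`, EVERY flow family `Φ` and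
  EVERY horizon `t`** (`hydroRate_equilibrium`, one-line header in the registered-stub format).
So the registered statement is TRUE and kernel-checked on the equilibrium rung; out of equilibrium `ℓ_s` is no
longer a function of the conserved totals and the statement is the open rated hydrodynamic limit.

## (A) Producer audit (tree @ 2026-08-16, 1261 route items of `Theses/*.lean`, 612 open; `Theorems/` 1724 files)

No landed theorem and no open route item implies `LinearHydroRateAt` verbatim.  Rated (`(N+1)^{-·}`) field or
entropy statements at FIXED times under the crux prefix exist in exactly one open route:
* NEAREST: `Theses.KnudsenRateHorizon.EntropyKnudsenRate` (stmt-AtomisticToContinuum-12339, target of route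
  KnudsenRateHorizon, open): `klDiv((Φ_t)_* μ₀ ‖ localGibbsLaw σ a u_t θ_t) ≤ C(N+1)^{2/3}` for every `t < T`, for SOME
  reference activity `a` whose local Gibbs law concentrates exponentially around `(ρ, ρu, E)(t)` — Yau's relative
  entropy AT KNUDSEN RATE.  By the line's identity `H(μ_s|G_s) = bracket − (N+1)E[ℓ_s]` this is the same currency;
  with the entropy inequality and concentration of `ℓ_s` under the reference law at scale `(N+1)^{-b}` it gives
  `LinearHydroRateAt` with any `b < 1/6`, `p < 1/3 − 2b`, MODULO (α) local uniformity of its constant `C` in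
  `s ∈ [0,t]` (the item has `∀ t, ∃ C`) and (β) flow-free statics (moderate deviations of the Λ-tested statistic
  under the tilted local Gibbs law; identification `a ∝ exp(λ₀ + |u|²/2θ)(2πθ)^{3/2}` by activity–density duality).
* Its decomposition in that route: `MeanFieldKnudsenAccuracy` (stmt-12341, crux rank 3: the Λ-tested linear
  statistic IN THE MEAN at rate `(N+1)^{-1/3}` — nearest in FORM) + `EntropySaturationKnudsen` (stmt-14322, support:
  `|H/(N+1) − Θ_N| ≤ C(N+1)^{-1/3}`), both `open-problem`/unprinted (Yau 1991 / OVY 1993 give `o(N)` with noise only).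
* Not producers: `RelEntropyVanishing` (stmt-0766, 25 routes: `H = o(N)`, unrated), `GermanoSplitLES.KineticRangeControl`
  (stmt-9201: a box bound, no rate, no Euler values), `CollisionIsometryCLT.AdaptedWeightCLT` (stmt-14868: `L²`
  vanishing of stresses, unrated), `MacroClosure` (stmt-14870: implication chain to the unrated conjunct), the
  `…ClosureCost`/`KineticFluxLdDecay`/`SlabMomentumClosure` families (rated CURRENTS/increments over windows, not
  fields at fixed times), `FirstFailureZoom.SmallDataHydrodynamics` (stmt-12934: unrated small-data limit),
  `TwoClocks.KineticWindowLDUniform` (stmt-14442: window LD for fast one-body functionals orthogonal to `1, v, |v|²`).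

## (C) Misstatement check: none found

`tiltMean` is a Bochner integral over `𝕋³` of a function continuous in `x` once `ρσ³` stays in the EOS chamber
`(0, η_e)` where `f_ex, f_ex'` are continuous (`hsEosLowDensity_proof`; the prover of the stub CHOOSES `η₁ ≤ η_e`),
`lam0` uses `Real.log` of positive fields, `linStat_eq` is unconditional (finite sum), the laws are probability
measures for `σ < σ₀ ≤ 1/2`, and at `s = 0` the statement is a rated static LLN for local Gibbs states (bias
`O(N^{-1})` canonical corrections, fluctuations `O(N^{-1/2})`), consistent with `∃ b p > 0`.
-/

noncomputable section

open MeasureTheory Filter Set Topology ProbabilityTheory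
open scoped ENNReal

namespace Summit.AtomisticToContinuum.HydrodynamicLimit.Theorems.FibreDeficitTransfer

open Literature.MathematicalPhysics.KineticTheory Literature.Analysis.FluidPDE
open Summit.AtomisticToContinuum.HydrodynamicLimit.Theorems.AprioriBoundsNegative (PartOneAt PartTwoAt)
open Summit.AtomisticToContinuum.HydrodynamicLimit.Theorems.VisitLedgerUpscattering (Cfg Flow Flows NiceProfiles)

namespace HydroRateEquilibrium

/-! ## The linear statistic at a constant state `(1, uc, θc)` -/

/-- The unit torus `𝕋³` has volume one. -/
theorem volume_univ_T3 : volume (univ : Set T3) = 1 := by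
  rw [volume_pi, Measure.pi_univ]
  simp

/-- At the constant state `(r, uc, θc)` the tilt exponent is `λ₀(r, θc, uc) + ⟪uc, v⟫/θc − |v|²/(2θc)`. -/
theorem tiltExponent_const (σ r θc : ℝ) (uc : V3) (s : ℝ) (y : T3 × V3) :
    tiltExponent σ (fun _ _ => r) (fun _ _ => θc) (fun _ _ => uc) s y =
      lam0 σ r θc uc + inner ℝ uc y.2 / θc - ‖y.2‖ ^ 2 / (2 * θc) := rfl

/-- At the constant state `(r, uc, θc)` the Euler mean of the tilt is `r (λ₀ + |uc|²/(2θc) − 3/2)` (`|𝕋³| = 1`). -/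
theorem tiltMean_const (σ r θc : ℝ) (uc : V3) (s : ℝ) :
    tiltMean σ (fun _ _ => r) (fun _ _ => θc) (fun _ _ => uc) s =
      r * (lam0 σ r θc uc + ‖uc‖ ^ 2 / (2 * θc) - 3 / 2) := by
  haveI : IsProbabilityMeasure (volume : Measure T3) := ⟨volume_univ_T3⟩
  simp [tiltMean]

/-- At the constant state `(1, uc, θc)` the linear statistic is a function of the total momentum `P` and the
kinetic energy `E`: `ℓ_s(w) = 3/2 − |uc|²/(2θc) + (⟪uc, P(w)⟫ − E(w))/((N+1)θc)`. -/
theorem linStat_const (σ θc : ℝ) (uc : V3) (s : ℝ) {N : ℕ} (w : Cfg N) :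
    linStat σ (fun _ _ => (1 : ℝ)) (fun _ _ => θc) (fun _ _ => uc) s w =
      3 / 2 - ‖uc‖ ^ 2 / (2 * θc) +
        ((N + 1 : ℕ) : ℝ)⁻¹ * ((inner ℝ uc (configMomentum w) - configEnergy w) / θc) := by
  rw [linStat_eq, tiltPot, tiltMean_const]
  simp only [tiltExponent_const, Finset.sum_sub_distrib, Finset.sum_add_distrib, Finset.sum_const,
    Finset.card_univ, Fintype.card_fin, nsmul_eq_mul, one_mul]
  have hn : ((N + 1 : ℕ) : ℝ) ≠ 0 := by positivity
  rw [configEnergy, configMomentum, inner_sum, ← Finset.sum_div, ← Finset.sum_div]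
  set SI : ℝ := ∑ i, inner ℝ uc (w i).2
  set SE : ℝ := ∑ i, ‖(w i).2‖ ^ 2
  field_simp
  ring

/-- On the good set the linear statistic at the constant state is conserved along the flow
(conservation of the kinetic energy and of the total momentum, `HardSphereFlow.configEnergy_flow`,
`HardSphereFlow.configMomentum_flow`). -/
theorem linStat_const_flow (σ θc : ℝ) (uc : V3) (s r : ℝ) {N : ℕ} (Φ : Flow σ N) {z : Cfg N} (hz : z ∈ Φ.good) :
    linStat σ (fun _ _ => (1 : ℝ)) (fun _ _ => θc) (fun _ _ => uc) s (Φ.flow r z) =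
      linStat σ (fun _ _ => (1 : ℝ)) (fun _ _ => θc) (fun _ _ => uc) s z := by
  rw [linStat_const, linStat_const, Φ.configEnergy_flow hz r, Φ.configMomentum_flow hz r]

/-! ## The equilibrium instance of `LinearHydroRateAt` -/

/-- Monotonicity of a measure along an inclusion holding on a conull set. -/
theorem measure_le_of_subset_on {α : Type*} [MeasurableSpace α] {μ : Measure α}
    {g A B : Set α} (hg : μ gᶜ = 0) (h : ∀ x ∈ g, x ∈ A → x ∈ B) : μ A ≤ μ B :=
  calc μ A ≤ μ (gᶜ ∪ B) := measure_mono fun x hx => by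
          by_cases hxg : x ∈ g
          · exact Or.inr (h x hxg hx)
          · exact Or.inl hxg
    _ ≤ μ gᶜ + μ B := measure_union_le _ _
    _ = μ B := by rw [hg, zero_add]

/-- Real arithmetic of the rate: with `τ = n^{1/4} ≥ B`, `B / (n · (n^{-1/4})²) ≤ n^{-1/4}`. -/
theorem rate_arith {n B : ℝ} (hn : 0 < n) (hB : B ≤ n ^ (1 / 4 : ℝ)) :
    B / (n * (n ^ (-(1 / 4 : ℝ))) ^ 2) ≤ n ^ (-(1 / 4 : ℝ)) := by
  set τ : ℝ := n ^ (1 / 4 : ℝ) with hτ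
  have hτpos : 0 < τ := Real.rpow_pos_of_pos hn _
  have hneg : n ^ (-(1 / 4 : ℝ)) = τ⁻¹ := by rw [Real.rpow_neg hn.le, hτ]
  have hn4 : n = τ ^ 4 := by
    rw [hτ, ← Real.rpow_natCast, ← Real.rpow_mul hn.le]; norm_num
  rw [hneg, hn4, div_le_iff₀ (by positivity)]
  calc B ≤ τ := hB
    _ = τ⁻¹ * (τ ^ 4 * τ⁻¹ ^ 2) := by field_simp

/-- The Galilean shift `w ↦ uc + √θc w` turns the centred normalised peculiar energy
`Y(v) = θc⁻¹(|v − uc|²/2 − 3θc/2)` into `(|w|² − 3)/2`. -/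
theorem peculiarEnergy_shift {θc : ℝ} (hθc : 0 < θc) (uc w : V3) :
    θc⁻¹ * (‖(uc + Real.sqrt θc • w) - uc‖ ^ 2 / 2 - Fintype.card (Fin 3) * θc / 2) =
      2⁻¹ * (‖w‖ ^ 2 - Fintype.card (Fin 3)) := by
  rw [add_sub_cancel_left, norm_smul, Real.norm_eq_abs, abs_of_nonneg (Real.sqrt_nonneg θc), mul_pow,
    Real.sq_sqrt hθc.le]
  field_simp

end HydroRateEquilibrium

open HydroRateEquilibrium in
/-- **EQUILIBRIUM INSTANCE OF `stub_hydroRate`** (registered sub-goal `hydroRate_equilibrium` of the crux).  At constant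
profiles `(ac, uc, θc)` and the constant classical solution `(1, uc, θc)` (`DenseExcursionUntied.isHardSphereEulerSolution_const`),
`LinearHydroRateAt` holds with `b = p = 1/4` for every `σ ≤ 1/2`, every flow family and every horizon: on the good set
`ℓ_s(Φ_s z) = ℓ_s(z) = −(N+1)⁻¹∑ᵢ Y(vᵢ)` with `Y(v) = θc⁻¹(|v − uc|²/2 − 3θc/2)` (conservation of energy and momentum,
`linStat_const_flow`), `Y` is centred with variance `≤ K/4` under `N(uc, θc)` (`K = gaussFourthMomentConst (Fin 3)`, by the
Galilean shift to the standard Gaussian), and Bienaymé–Chebyshev given the positions (`localGibbsMeasure_velFluct_le`)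
bounds the bad event by `(K/4)(N+1)^{-1/2} ≤ (N+1)^{-1/4}` once `(N+1)^{1/4} ≥ K/4`. -/
theorem hydroRate_equilibrium : ∀ (σ ac θc : ℝ) (uc : V3), σ ≤ 1 / 2 → 0 < ac → 0 < θc → ∀ (Φ : (N : ℕ) → HardSphereFlow (Torus.geometry (Fin 3)) (hsDiameter σ N) (N + 1)) (t : ℝ), LinearHydroRateAt σ (fun _ => ac) (fun _ => θc) (fun _ => uc) (fun _ _ => 1) (fun _ _ => θc) (fun _ _ => uc) Φ t := by
  intro σ ac θc uc hσ2 hac hθc Φ t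
  -- the centred, normalised peculiar kinetic energy and its statistics under `N(uc, θc)`
  set Y : V3 → ℝ := fun v => θc⁻¹ * (‖v - uc‖ ^ 2 / 2 - Fintype.card (Fin 3) * θc / 2) with hY
  have hYc : Continuous Y := by rw [hY]; fun_prop
  have hYm : Measurable Y := hYc.measurable
  have hshift : Y ∘ (fun w : V3 => uc + Real.sqrt θc • w) = fun w => 2⁻¹ * (‖w‖ ^ 2 - Fintype.card (Fin 3)) := by
    funext w; simp only [Function.comp_apply, hY]; exact peculiarEnergy_shift hθc uc w
  have hY0 : ∫ v, Y v ∂gaussMeasure uc θc = 0 := by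
    rw [integral_gaussMeasure uc hθc Y, show (fun w : V3 => Y (uc + Real.sqrt θc • w)) =
      Y ∘ (fun w : V3 => uc + Real.sqrt θc • w) from rfl, hshift, integral_const_mul,
      integral_sub integrable_norm_sq_stdGaussian (integrable_const _), integral_norm_sq_stdGaussian]
    simp
  have hYsq : Integrable (fun v => Y v ^ 2) (gaussMeasure uc θc) := by
    have hmeas : AEStronglyMeasurable (fun v => Y v ^ 2) (gaussMeasure uc θc) := (hYc.pow 2).aestronglyMeasurable
    rw [gaussMeasure] at hmeas ⊢
    refine (integrable_map_measure hmeas (measurable_gaussShift uc θc).aemeasurable).2 ?_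
    have h : (fun v => Y v ^ 2) ∘ (fun w : V3 => uc + Real.sqrt θc • w) =
        fun w => (2⁻¹) ^ 2 * (‖w‖ ^ 2 - Fintype.card (Fin 3)) ^ 2 := by
      funext w
      have hw := congrFun hshift w
      simp only [Function.comp_apply] at hw ⊢
      rw [hw, mul_pow]
    rw [h]
    exact integrable_norm_sq_sub_card_sq.const_mul _
  have hY2 : MemLp Y 2 (gaussMeasure uc θc) := (memLp_two_iff_integrable_sq hYc.aestronglyMeasurable).2 hYsq
  set B : ℝ := (2⁻¹) ^ 2 * gaussFourthMomentConst (Fin 3) with hBdef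
  have hYB : Var[Y; gaussMeasure uc θc] ≤ B := by
    refine (variance_le_expectation_sq hYc.aestronglyMeasurable).trans (le_of_eq ?_)
    simp only [Pi.pow_apply]
    rw [integral_gaussMeasure uc hθc (fun v => Y v ^ 2), hBdef, gaussFourthMomentConst, ← integral_const_mul]
    refine integral_congr_ae (Eventually.of_forall fun w => ?_)
    have hw := congrFun hshift w
    simp only [Function.comp_apply] at hw
    simp only [hw, mul_pow]
  -- `ℓ_s(w) = −(N+1)⁻¹ ∑ᵢ 1 · Y(vᵢ)`: per particle, `Λ·(1, v, |v|²/2) − m = −Y(v)`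
  have hpt : ∀ (s : ℝ) (y : T3 × V3), tiltExponent σ (fun _ _ => (1 : ℝ)) (fun _ _ => θc) (fun _ _ => uc) s y -
      (lam0 σ 1 θc uc + ‖uc‖ ^ 2 / (2 * θc) - 3 / 2) = -Y y.2 := fun s y => by
    simp only [tiltExponent_const, hY, norm_sub_sq_real, Fintype.card_fin, Nat.cast_ofNat]
    rw [real_inner_comm uc y.2]
    field_simp
    ring
  have havg : ∀ (s : ℝ) {N : ℕ} (w : Cfg N),
      linStat σ (fun _ _ => (1 : ℝ)) (fun _ _ => θc) (fun _ _ => uc) s w =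
        -(((N + 1 : ℕ) : ℝ)⁻¹ * ∑ i, (fun _ : T3 => (1 : ℝ)) (w i).1 * Y (w i).2) := fun s N w => by
    have hn : ((N + 1 : ℕ) : ℝ) ≠ 0 := by positivity
    have hS : ∑ i, tiltExponent σ (fun _ _ => (1 : ℝ)) (fun _ _ => θc) (fun _ _ => uc) s (w i) =
        ∑ i, (-Y (w i).2 + (lam0 σ 1 θc uc + ‖uc‖ ^ 2 / (2 * θc) - 3 / 2)) :=
      Finset.sum_congr rfl fun i _ => by rw [← hpt s (w i)]; ring
    rw [linStat_eq, tiltPot, tiltMean_const, hS, Finset.sum_add_distrib, Finset.sum_const, Finset.card_univ,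
      Fintype.card_fin, Finset.sum_neg_distrib, nsmul_eq_mul, mul_add, inv_mul_cancel_left₀ hn]
    simp only [one_mul]
    ring
  -- the threshold `N₀`: `(N+1)^{1/4} ≥ B`
  have hT : Tendsto (fun N : ℕ => ((N : ℝ) + 1) ^ (1 / 4 : ℝ)) atTop atTop :=
    (tendsto_rpow_atTop (by norm_num)).comp
      (tendsto_atTop_add_const_right _ 1 tendsto_natCast_atTop_atTop)
  obtain ⟨N₀, hN₀⟩ := eventually_atTop.1 (hT.eventually_ge_atTop B)
  refine ⟨1 / 4, 1 / 4, by norm_num, by norm_num, N₀, fun N hN s _ => ?_⟩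
  have hn : (0 : ℝ) < (N : ℝ) + 1 := by positivity
  have hcast : ((N + 1 : ℕ) : ℝ) = (N : ℝ) + 1 := by push_cast; ring
  -- the constant profiles are nice; the local Gibbs law is a probability measure for `σ ≤ 1/2`
  have hacc : Continuous (fun _ : T3 => ac) := continuous_const
  have hθcc : Continuous (fun _ : T3 => θc) := continuous_const
  have hucc : Continuous (fun _ : T3 => uc) := continuous_const
  haveI : IsProbabilityMeasure (localGibbsMeasure σ (fun _ => ac) (fun _ => uc) (fun _ => θc) N) :=
    isProbabilityMeasure_localGibbsMeasure hacc hθcc hucc (fun _ => hac) (fun _ => hθc) hσ2 N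
  -- Bienaymé–Chebyshev for the velocity fluctuation, conditionally on the positions
  set δ : ℝ := ((N : ℝ) + 1) ^ (-(1 / 4 : ℝ)) with hδ
  have hδpos : 0 < δ := Real.rpow_pos_of_pos hn _
  have hcheb := localGibbsMeasure_velFluct_le (a₀ := fun _ => ac) (θ₀ := fun _ => θc) (u₀ := fun _ => uc)
    hacc hθcc hucc (fun _ => hac.le) (fun _ => hθc) σ N
    (Y := fun _ v => Y v) (hYm.comp measurable_snd) (fun _ => hY2) (fun _ => hY0) (B := B)
    (fun _ => hYB) (χ := fun _ => (1 : ℝ)) continuous_const (C := 1) (fun _ => by simp) hδpos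
  -- the law is carried by the good set, on which `ℓ_s ∘ Φ_s = ℓ_s` is the velocity fluctuation
  have hg : localGibbsLaw σ (fun _ => ac) (fun _ => uc) (fun _ => θc) N (Φ N) (Φ N).goodᶜ = 0 := by
    rw [localGibbsLaw_eq]
    exact localGibbsMeasure_absolutelyContinuous σ _ _ _ N (Φ N) (Φ N).measure_compl_good
  calc localGibbsLaw σ (fun _ => ac) (fun _ => uc) (fun _ => θc) N (Φ N)
        {z | ((N : ℝ) + 1) ^ (-(1 / 4 : ℝ)) <
          |linStat σ (fun _ _ => (1 : ℝ)) (fun _ _ => θc) (fun _ _ => uc) s ((Φ N).flow s z)|}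
      ≤ localGibbsLaw σ (fun _ => ac) (fun _ => uc) (fun _ => θc) N (Φ N)
          {z | δ ≤ |((N + 1 : ℕ) : ℝ)⁻¹ * ∑ i, (fun _ : T3 => (1 : ℝ)) (z i).1 * Y (z i).2|} := by
        refine measure_le_of_subset_on hg fun z hz hbad => ?_
        simp only [mem_setOf_eq] at hbad ⊢
        rw [linStat_const_flow σ θc uc s s (Φ N) hz, havg s z, abs_neg] at hbad
        exact hbad.le
    _ = localGibbsMeasure σ (fun _ => ac) (fun _ => uc) (fun _ => θc) N
          {z | δ ≤ |((N + 1 : ℕ) : ℝ)⁻¹ * ∑ i, (fun _ : T3 => (1 : ℝ)) (z i).1 * Y (z i).2|} := by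
        rw [localGibbsLaw_eq]
    _ ≤ ENNReal.ofReal (1 ^ 2 * B / ((N + 1 : ℕ) * δ ^ 2)) := hcheb
    _ ≤ ENNReal.ofReal (((N : ℝ) + 1) ^ (-(1 / 4 : ℝ))) := by
        refine ENNReal.ofReal_le_ofReal ?_
        rw [one_pow, one_mul, hcast, hδ]
        exact rate_arith hn (hN₀ N hN)

end Summit.AtomisticToContinuum.HydrodynamicLimit.Theorems.FibreDeficitTransfer

end
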